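import Mathlib
import HarnessLib
import Summits.HubbardSuperconductivity.HubbardSuperconductivity.Theorems.KLProgrammeKLRegimeVolumeLimitGibbsDoor
import Summits.HubbardSuperconductivity.HubbardSuperconductivity.Theorems.KLProgrammeKLRegimeSplitBundleV16
import Summits.HubbardSuperconductivity.HubbardSuperconductivity.Theses.KLProgramme

/-!
# Gen-6 VL child `KLRegimeVolumeLimitV16` (stmt-HubbardSuperconductivity-20239): the ROUTE DECL from the thermodynamic limit of the torus Gibbs state at
# finitely many local observables — by-`--workitem` closer (seat hubbard-kl-k3c5-p3 g7, VL co-registrant; technique «OS-positivity-free direct assembly»)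

Thin sequel of …VolumeLimitGibbsDoor (`volumeLimitP2_of_gibbsLimitText (Pr W)`), instantiated at `(klPredsV16, klWindowC)` through `klPredsV16_frameOK_imp`.
Hypothesis (inside the regime binders): (G-dens) the density `⟨c†_{0↓}c_{0↓}⟩_{β,U,μ+U/2,L}` converges as `L → ∞`; (G-pair) for each Matsubara integer `n`
and lattice offset `z ∈ ℤ²` the Matsubara coefficient `∫₀^β e^{iω_nτ}⟨τ_τ(A_0)A_{proj_L z}†⟩_{β,H_L} dτ` (`A_x = c_{x↑}n_{x↓} − ½c_{x↑}`,
`H_L = hubbardTorusWith 2 L 1 U (μ + U/2)`) converges as `L → ∞`.  Everything is proved; no definition; nothing is asserted about the model.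
-/

noncomputable section

namespace Summit.HubbardSuperconductivity.HubbardSuperconductivity.Theorems.TwoPointAssembly

set_option linter.dupNamespace false -- summit = problem name (single-conjunct summit), D-0017

open scoped ComplexConjugate
open Matrix Complex Finset Filter Topology Literature.MathematicalPhysics.QuantumLattice Literature.Probability.LatticeModels
open Literature.MathematicalPhysics.QuantumLattice.FermiRG
open Summit.HubbardSuperconductivity.HubbardSuperconductivity.Theorems.DispersionFlow
open Summit.HubbardSuperconductivity.HubbardSuperconductivity.Theorems.KLRegimeSplit
open Summit.HubbardSuperconductivity.HubbardSuperconductivity.Theorems.KLProgrammeLegKernels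

/-- **The gen-6 VL child `KLRegimeVolumeLimitV16` (stmt-…-20239) from the thermodynamic limit of the torus Gibbs state at finitely many local observables**
(the (G-dens)/(G-pair) text at `klPredsV16`, `klWindowC`; by-`--workitem` closer). -/
theorem KLRegimeVolumeLimitV16_of_gibbsLimitText
    (hG : ∀ (G : GeoConsts) (P : SplitConsts) (Q : EngConsts) (R : RenConsts), G.WF → P.WF → Q.WF → R.WF →
      ∃ c₅ : ℝ, 0 < c₅ ∧ ∀ c : ℝ, 0 < c → c ≤ c₅ → ∃ U₀ : ℝ, 0 < U₀ ∧
        ∀ μ ∈ klWindowC, ∀ U : ℝ, 0 < U → U ≤ U₀ → ∀ β : ℝ, klBetaMin ≤ β → β ≤ Real.exp (c / U ^ 2) →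
          ∀ K : TrigPolyC4v, klPredsV16.frameOK R U (nScales β) μ K →
            ∀ (Lstar : ℕ) (Mstar : ℕ → ℕ), TowerP klPredsV16 G P Q R β U μ K Lstar Mstar →
              (∃ d : ℂ, ∀ ε > (0 : ℝ), ∃ L₁ : ℕ, ∀ (L : ℕ) [NeZero L], L₁ ≤ L →
                  ‖hubbardThermalTwoPoint β U (μ + U / 2) L 0 0 1 1 - d‖ ≤ ε) ∧
              ∀ (n : ℤ) (z : Site 2), ∃ h : ℂ, ∀ ε > (0 : ℝ), ∃ L₁ : ℕ, ∀ (L : ℕ) [NeZero L], L₁ ≤ L →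
                ‖(∫ τ in (0 : ℝ)..β, cexp (I * ((Real.pi * (2 * (n : ℝ) + 1) / β : ℝ) : ℂ) * τ) *
                    gibbsState β (hubbardTorusWith 2 L 1 U (μ + U / 2))
                      (imagTimeEvolve (hubbardTorusWith 2 L 1 U (μ + U / 2)) (τ : ℂ)
                        (annihilation (orb (FermionTorus.ofTorusSite (0 : TorusSite 2 L)) 0) *
                            numberOp (FermionTorus.ofTorusSite (0 : TorusSite 2 L)) 1 -
                          (1 / 2 : ℂ) • annihilation (orb (FermionTorus.ofTorusSite (0 : TorusSite 2 L)) 0)) *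
                        (annihilation (orb (FermionTorus.ofTorusSite (Torus.proj L z)) 0) *
                            numberOp (FermionTorus.ofTorusSite (Torus.proj L z)) 1 -
                          (1 / 2 : ℂ) • annihilation (orb (FermionTorus.ofTorusSite (Torus.proj L z)) 0))ᴴ)) - h‖ ≤ ε) :
    Summit.HubbardSuperconductivity.HubbardSuperconductivity.Theses.KLProgramme.KLRegimeVolumeLimitV16 :=
  volumeLimitP2_of_gibbsLimitText klPredsV16 klWindowC klPredsV16_frameOK_imp hG

end Summit.HubbardSuperconductivity.HubbardSuperconductivity.Theorems.TwoPointAssembly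

end
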